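import Summits.Ventures.YMGap.Census.FieldRP
import Summits.Ventures.YMGap.Census.CubeMerge
import Mathlib.Analysis.MeanInequalities
import HarnessLib

/-!
# Venture YMGap, track (b) — POTENTIAL MOVING bounds the partition function above
# (Tomboulis, arXiv:0707.2179, Prop. III.1 / App. A §4: the elementary moving step and its iteration)

HONEST FRAMING: venture file of the cell `pub-ymgap` (QuantumFields programme), track (b); finite tori `(ℤ/bLℤ)^d`
only, on the positivity domain `f_c ≥ 0` of the plaquette function; nothing about (5.15), limits, confinement or a mass gap.

Tomboulis's potential-moving (Migdal–Kadanoff) decimation `a → b a` ((2.17), §2.1, App. A §4 (A.14)–(A.19)) first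
replaces, for every direction `κ` and every plaquette `p ⊥ κ`, the weight `f(U_p)` by `f(U_p)^b` if the `κ`-coordinate of
`p` is `≡ 0 (mod b)` (the "receiving" plaquettes `Q⁺`) and by `1` otherwise (the moved plaquettes `Q⁻`); after all `d`
directions the plaquettes on the coarse `2`-skeleton carry `f^ζ`, `ζ = b^{d-2}`, and all others carry `1`.  App. A §4
proves that each elementary step does not decrease `Z`: the interpolating family `ξ ↦ Z(ξ)` is convex and
`dZ/dξ|₀ = 0` by translation invariance iff `ζ₀ = b` ((A.15)–(A.17), (MKchoice)).  This file proves the same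
inequality in its DISCRETE form — pointwise AM–GM over the `b` cyclic `κ`-translates of the receiving pattern
(convexity) plus invariance of the product Haar measure under lattice translations (translation invariance) — with
the same two ingredients and no `ξ`-derivatives, for EVERY `d`, `b ≥ 1`, `L ≥ 1`, spin cut-off `J` and every
coefficient vector `c` with `f_c ≥ 0` on `SU(2)` (Tomboulis's standing hypothesis (2.34) `f_p(U, n) > 0`, under
which alone the action `A_p = ln f_p` of (A.14) exists):

* `powFieldFn`, `powFieldZ` — `Z(e) = ∫ ∏_p f_c(U_p)^{e_p} ∏ dU` for an exponent field `e : plaquettes → ℕ`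
  (`torusZ_eq_powFieldZ_one`); `powFieldZ_comp_plaqShift` (translation invariance).
* `sliceExp`, `moveExp` — the elementary move along `κ` applied to ALL plaquettes `⊥ κ` at once (this keeps translation
  invariance in the unprocessed directions, App. A §4 "regardless of any previous moves performed along other
  directions"); **`powFieldZ_le_powFieldZ_moveExp`** — `Z(e) ≤ Z(move_κ e)` for `κ`-translation-invariant `e`.
* `mkExpS` — the exponent field after processing a set `S` of directions; `moveExp_mkExpS`;
  **`torusZ_le_powFieldZ_mkExpS`** and **`torusZ_fine_le_powFieldZ_mkExp`** —
  `Z_{(ℤ/bL)^d}({c_j}) ≤ Z(e_MK)`, `e_MK = b^{d-2}` on the plaquettes of the coarse `2`-skeleton and `0` elsewhere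
  (`mkExpS_univ`): potential moving gives an UPPER bound (the inequality half of Prop. III.1; the exact `2`-dimensional
  integrations that turn `Z(e_MK)` into `F₀^U(1)^{|Λ^{(1)}|} Z_{Λ^{(1)}}({c^U_j})` are a separate file).

References: E. T. Tomboulis, arXiv:0707.2179, §2.1 and App. A §4 (A.14)–(A.19) [cite: Tomboulis2007Confinement, Prop. III.1,
App. A §4]; A. A. Migdal, Sov. Phys. JETP 42 (1975) 413; L. P. Kadanoff, Ann. Phys. 100 (1976) 359 (potential moving)
[folklore].
-/

noncomputable section

open MeasureTheory Finset Real
open scoped BigOperators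
open Literature.MathematicalPhysics.QuantumLattice
open Literature.MathematicalPhysics.QuantumFieldTheory
open Literature.MathematicalPhysics.QuantumFieldTheory.Tomboulis2007
open Literature.MathematicalPhysics.QuantumFieldTheory.WilsonRP
open Summit.Ventures.LatticeQCDFlow.Exactness
open Summit.Ventures.LatticeQCDFlow.Scoring

namespace Summit.Ventures.YMGap.Census

variable {d L : ℕ}

/-! ### Exponent fields and their partition function -/

/-- The integrand `∏_p f_c(U_p)^{e_p}` of an exponent field `e`. -/
def powFieldFn [NeZero L] (J : ℕ) (c : ℕ → ℝ) (e : Plaquette d L → ℕ) (W : GaugeConfig d L SU2) : ℝ :=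
  ∏ p, fR J c (plaqRe rhoFund W p) ^ e p

/-- **The partition function of an exponent field**: `Z(e) = ∫ ∏_p f_c(U_p)^{e_p} ∏_b dU_b` on `(ℤ/Lℤ)^d`
(Tomboulis's `Z_Λ(m, ξ)` of (A.14) at the integer points of the moving interpolation). -/
def powFieldZ [NeZero L] (J : ℕ) (c : ℕ → ℝ) (e : Plaquette d L → ℕ) : ℝ :=
  ∫ W, powFieldFn J c e W ∂(Measure.pi fun _ : Edge d L => haarProbability SU2)

section Basic

variable [NeZero L]

/-- `Z_Λ({c_j})` is the partition function of the constant exponent field `1`. -/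
theorem torusZ_eq_powFieldZ_one (J : ℕ) (c : ℕ → ℝ) :
    torusZ d L J c = powFieldZ J c (fun _ : Plaquette d L => 1) := by
  unfold torusZ powFieldZ powFieldFn
  simp only [pow_one]
  rfl

/-- The integrand is continuous. -/
theorem continuous_powFieldFn (J : ℕ) (c : ℕ → ℝ) (e : Plaquette d L → ℕ) : Continuous (powFieldFn J c e) := by
  unfold powFieldFn
  exact continuous_finsetProd _ fun p _ => ((continuous_fR J c).comp (continuous_plaqRe p)).pow _

/-- The integrand is non-negative on the positivity domain `f_c ≥ 0`. -/
theorem powFieldFn_nonneg (J : ℕ) {c : ℕ → ℝ} (hf : ∀ g : SU2, 0 ≤ plaqFn J c g) (e : Plaquette d L → ℕ)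
    (W : GaugeConfig d L SU2) : 0 ≤ powFieldFn J c e W :=
  Finset.prod_nonneg fun p _ => pow_nonneg (by rw [← plaqFn_hol_eq_fR]; exact hf _) _

/-- The integrand intertwines lattice translations. -/
theorem powFieldFn_configShift (J : ℕ) (c : ℕ → ℝ) (e : Plaquette d L → ℕ) (v : Site d L) (W : GaugeConfig d L SU2) :
    powFieldFn J c (fun p => e (plaqShift v p)) (configShift v W) = powFieldFn J c e W := by
  unfold powFieldFn
  simp only [plaqRe_configShift]
  exact Fintype.prod_equiv (plaqShiftEquiv v) _ _ fun p => by rw [plaqShiftEquiv_apply]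

/-- **Translation invariance**: relabelling the exponent field along a lattice translation does not change `Z(e)`. -/
theorem powFieldZ_comp_plaqShift (J : ℕ) (c : ℕ → ℝ) (e : Plaquette d L → ℕ) (v : Site d L) :
    powFieldZ J c (fun p => e (plaqShift v p)) = powFieldZ J c e := by
  unfold powFieldZ
  rw [← (measurePreserving_configShiftEquiv (haarProbability SU2) v).integral_comp'
    (powFieldFn J c fun p => e (plaqShift v p))]
  refine integral_congr_ae (ae_of_all _ fun W => ?_)
  simp only [configShiftEquiv_apply, powFieldFn_configShift]

omit [NeZero L] in
/-- `plaqShift (u + w) = plaqShift w ∘ plaqShift u`. -/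
theorem plaqShift_add (u w : Site d L) (p : Plaquette d L) : plaqShift (u + w) p = plaqShift w (plaqShift u p) := by
  unfold plaqShift
  simp only [add_assoc]

/-- A field invariant under the unit translation `e_κ` is invariant under every translation along `κ`. -/
theorem comp_plaqShift_single_of_unit {α : Type*} {e : Plaquette d L → α} {κ : Fin d}
    (he : ∀ p, e (plaqShift (Pi.single κ 1) p) = e p) (z : ZMod L) (p : Plaquette d L) :
    e (plaqShift (Pi.single κ z) p) = e p := by
  have hnat : ∀ n : ℕ, ∀ q, e (plaqShift (Pi.single κ (n : ZMod L)) q) = e q := by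
    intro n
    induction n with
    | zero => intro q; simp [plaqShift]
    | succ n ih =>
      intro q
      rw [Nat.cast_succ, Pi.single_add, plaqShift_add, he, ih]
  rw [← ZMod.natCast_zmod_val z]
  exact hnat z.val p

end Basic

/-! ### The elementary move along a direction `κ` on the torus `(ℤ/bLℤ)^d` -/

section Move

variable (b : ℕ) [NeZero b] [NeZero L]

/-- The fine torus has `bL ≠ 0` sites per direction. -/
instance neZero_mul_side : NeZero (b * L) := ⟨mul_ne_zero (NeZero.ne b) (NeZero.ne L)⟩

/-- The residue class `mod b` of a coordinate of the fine torus `ℤ/bLℤ` (the position inside the decimation cell). -/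
def resb (L : ℕ) (x : ZMod (b * L)) : ZMod b := ZMod.castHom (dvd_mul_right b L) (ZMod b) x

omit [NeZero b] [NeZero L] in
/-- `resb` is additive. -/
theorem resb_add (x y : ZMod (b * L)) : resb b L (x + y) = resb b L x + resb b L y := map_add _ x y

omit [NeZero b] [NeZero L] in
/-- `resb` of a natural number. -/
theorem resb_natCast (n : ℕ) : resb b L (n : ZMod (b * L)) = n := map_natCast _ n

omit [NeZero b] [NeZero L] in
/-- `resb` commutes with negation. -/
theorem resb_neg (x : ZMod (b * L)) : resb b L (-x) = -resb b L x := map_neg _ x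

variable {b}

/-- The directions PERPENDICULAR to a plaquette `p` (`κ ⊥ p`: `κ` is not one of the two directions spanning `p`). -/
def perpDirs (p : Plaquette d L) : Finset (Fin d) := univ.filter fun κ => κ ≠ p.2.1.1 ∧ κ ≠ p.2.1.2

omit [NeZero L] in
/-- Membership in `perpDirs`. -/
theorem mem_perpDirs {κ : Fin d} {p : Plaquette d L} : κ ∈ perpDirs p ↔ κ ≠ p.2.1.1 ∧ κ ≠ p.2.1.2 := by
  simp [perpDirs]

omit [NeZero L] in
/-- Perpendicularity only sees the orientation: it is invariant under translations. -/
theorem perpDirs_plaqShift (v : Site d L) (p : Plaquette d L) : perpDirs (plaqShift v p) = perpDirs p := rfl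

variable (b)

/-- The `i`-th cyclic translate of the moved exponent field along `κ`: plaquettes `⊥ κ` with `κ`-coordinate
`≡ i (mod b)` receive `b · e_p`, the other plaquettes `⊥ κ` are switched off, plaquettes containing `κ` are untouched. -/
def sliceExp (κ : Fin d) (e : Plaquette d (b * L) → ℕ) (i : ZMod b) (p : Plaquette d (b * L)) : ℕ :=
  if κ ∈ perpDirs p then (if resb b L (p.1 κ) = i then b * e p else 0) else e p

/-- **The elementary potential move along `κ`** (arXiv:0707.2179 §2.1, Figure 1; App. A §4 `Q⁺ ∪ Q⁻`): the receiving
plaquettes (`κ`-coordinate `≡ 0 mod b`) carry `b · e_p`, the moved ones `0`. -/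
def moveExp (κ : Fin d) (e : Plaquette d (b * L) → ℕ) : Plaquette d (b * L) → ℕ := sliceExp b κ e 0

/-- The factors of the integrand not touched by the move (plaquettes containing `κ`). -/
def restFn (J : ℕ) (c : ℕ → ℝ) (κ : Fin d) (e : Plaquette d (b * L) → ℕ) (W : GaugeConfig d (b * L) SU2) : ℝ :=
  ∏ p ∈ univ.filter (fun p => κ ∉ perpDirs p), fR J c (plaqRe rhoFund W p) ^ e p

/-- The factors of the integrand on the plaquettes `⊥ κ` of residue `i`. -/
def sliceFn (J : ℕ) (c : ℕ → ℝ) (κ : Fin d) (e : Plaquette d (b * L) → ℕ) (i : ZMod b)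
    (W : GaugeConfig d (b * L) SU2) : ℝ :=
  ∏ p ∈ (univ.filter (fun p => κ ∈ perpDirs p)).filter (fun p => resb b L (p.1 κ) = i), fR J c (plaqRe rhoFund W p) ^ e p

/-- `∏_p f^{e_p} = rest × ∏_{i mod b} slice_i`. -/
theorem powFieldFn_eq_rest_mul_prod_slice (J : ℕ) (c : ℕ → ℝ) (κ : Fin d) (e : Plaquette d (b * L) → ℕ)
    (W : GaugeConfig d (b * L) SU2) :
    powFieldFn J c e W = restFn b J c κ e W * ∏ i : ZMod b, sliceFn b J c κ e i W := by
  unfold powFieldFn restFn sliceFn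
  rw [Finset.prod_fiberwise (univ.filter (fun p => κ ∈ perpDirs p)) (fun p : Plaquette d (b * L) => resb b L (p.1 κ))
    (fun p => fR J c (plaqRe rhoFund W p) ^ e p),
    ← Finset.prod_filter_mul_prod_filter_not univ (fun p => κ ∈ perpDirs p) (fun p => fR J c (plaqRe rhoFund W p) ^ e p),
    mul_comm]

/-- `∏_p f^{(slice_i e)_p} = rest × slice_i^b`. -/
theorem powFieldFn_sliceExp (J : ℕ) (c : ℕ → ℝ) (κ : Fin d) (e : Plaquette d (b * L) → ℕ) (i : ZMod b)
    (W : GaugeConfig d (b * L) SU2) :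
    powFieldFn J c (sliceExp b κ e i) W = restFn b J c κ e W * sliceFn b J c κ e i W ^ b := by
  unfold powFieldFn restFn sliceFn
  rw [← Finset.prod_filter_mul_prod_filter_not univ (fun p => κ ∈ perpDirs p), mul_comm]
  congr 1
  · refine Finset.prod_congr rfl fun p hp => ?_
    rw [sliceExp, if_neg (Finset.mem_filter.1 hp).2]
  · rw [← Finset.prod_pow, Finset.prod_filter (fun p : Plaquette d (b * L) => resb b L (p.1 κ) = i)]
    refine Finset.prod_congr rfl fun p hp => ?_
    rw [sliceExp, if_pos (Finset.mem_filter.1 hp).2]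
    split_ifs with h
    · rw [pow_mul']
    · rw [pow_zero]

/-- **AM–GM for the move**: pointwise, `∏_p f^{e_p} ≤ b⁻¹ Σ_{i mod b} ∏_p f^{(slice_i e)_p}` on `f_c ≥ 0`. -/
theorem powFieldFn_le_avg_slice (J : ℕ) {c : ℕ → ℝ} (hf : ∀ g : SU2, 0 ≤ plaqFn J c g) (κ : Fin d)
    (e : Plaquette d (b * L) → ℕ) (W : GaugeConfig d (b * L) SU2) :
    powFieldFn J c e W ≤ ∑ i : ZMod b, (b : ℝ)⁻¹ * powFieldFn J c (sliceExp b κ e i) W := by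
  have hfp : ∀ p : Plaquette d (b * L), 0 ≤ fR J c (plaqRe rhoFund W p) := fun p => by
    rw [← plaqFn_hol_eq_fR]; exact hf _
  have hR : 0 ≤ restFn b J c κ e W := Finset.prod_nonneg fun p _ => pow_nonneg (hfp p) _
  have hP : ∀ i, 0 ≤ sliceFn b J c κ e i W := fun i => Finset.prod_nonneg fun p _ => pow_nonneg (hfp p) _
  have hb0 : (b : ℝ) ≠ 0 := Nat.cast_ne_zero.2 (NeZero.ne b)
  -- AM–GM with equal weights `1/b` for the numbers `slice_i^b`
  have hamgm := Real.geom_mean_le_arith_mean_weighted (Finset.univ : Finset (ZMod b)) (fun _ => (b : ℝ)⁻¹)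
    (fun i => sliceFn b J c κ e i W ^ b) (fun _ _ => by positivity)
    (by rw [Finset.sum_const, Finset.card_univ, ZMod.card, nsmul_eq_mul, mul_inv_cancel₀ hb0])
    (fun i _ => pow_nonneg (hP i) b)
  have hgeo : ∏ i : ZMod b, (sliceFn b J c κ e i W ^ b) ^ ((b : ℝ)⁻¹) = ∏ i : ZMod b, sliceFn b J c κ e i W :=
    Finset.prod_congr rfl fun i _ => Real.pow_rpow_inv_natCast (hP i) (NeZero.ne b)
  rw [hgeo] at hamgm
  simp_rw [powFieldFn_sliceExp]
  rw [powFieldFn_eq_rest_mul_prod_slice b J c κ e W]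
  calc restFn b J c κ e W * ∏ i : ZMod b, sliceFn b J c κ e i W
      ≤ restFn b J c κ e W * ∑ i : ZMod b, (b : ℝ)⁻¹ * sliceFn b J c κ e i W ^ b :=
        mul_le_mul_of_nonneg_left hamgm hR
    _ = ∑ i : ZMod b, (b : ℝ)⁻¹ * (restFn b J c κ e W * sliceFn b J c κ e i W ^ b) := by
        rw [Finset.mul_sum]
        refine Finset.sum_congr rfl fun i _ => ?_
        ring

/-- The translate by `-i e_κ` of the receiving pattern is the `i`-th slice pattern, for a `κ`-translation-invariant `e`. -/
theorem sliceExp_eq_moveExp_comp_plaqShift (κ : Fin d) {e : Plaquette d (b * L) → ℕ}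
    (he : ∀ p, e (plaqShift (Pi.single κ 1) p) = e p) (i : ZMod b) :
    sliceExp b κ e i = fun p => moveExp b κ e (plaqShift (Pi.single κ (-(i.val : ZMod (b * L)))) p) := by
  funext p
  unfold moveExp sliceExp
  rw [comp_plaqShift_single_of_unit he]
  simp only [perpDirs_plaqShift]
  have hres : resb b L ((plaqShift (Pi.single κ (-(i.val : ZMod (b * L)))) p).1 κ) = resb b L (p.1 κ) - i := by
    simp only [plaqShift, Pi.add_apply, Pi.single_eq_same, resb_add, resb_neg, resb_natCast, ZMod.natCast_zmod_val,
      sub_eq_add_neg]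
  simp only [hres, sub_eq_zero]

/-- **The elementary potential-moving step is an upper bound** (arXiv:0707.2179 App. A §4, (A.15)–(A.18) with
`ζ₀ = b`): `Z(e) ≤ Z(move_κ e)` for every exponent field `e` invariant under the unit translation along `κ`, on the
positivity domain `f_c ≥ 0`. -/
theorem powFieldZ_le_powFieldZ_moveExp (J : ℕ) {c : ℕ → ℝ} (hf : ∀ g : SU2, 0 ≤ plaqFn J c g) (κ : Fin d)
    {e : Plaquette d (b * L) → ℕ} (he : ∀ p, e (plaqShift (Pi.single κ 1) p) = e p) :
    powFieldZ J c e ≤ powFieldZ J c (moveExp b κ e) := by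
  have hint : ∀ e' : Plaquette d (b * L) → ℕ, Integrable (powFieldFn J c e')
      (Measure.pi fun _ : Edge d (b * L) => haarProbability SU2) :=
    fun e' => integrable_pi_su2_of_continuous (continuous_powFieldFn J c e')
  calc powFieldZ J c e
      ≤ ∫ W, ∑ i : ZMod b, (b : ℝ)⁻¹ * powFieldFn J c (sliceExp b κ e i) W
          ∂(Measure.pi fun _ : Edge d (b * L) => haarProbability SU2) :=
        integral_mono (hint e) (integrable_finsetSum _ fun i _ => (hint _).const_mul _)
          fun W => powFieldFn_le_avg_slice b J hf κ e W
    _ = ∑ i : ZMod b, (b : ℝ)⁻¹ * powFieldZ J c (sliceExp b κ e i) := by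
        rw [integral_finsetSum _ fun i _ => (hint _).const_mul _]
        refine Finset.sum_congr rfl fun i _ => ?_
        rw [integral_const_mul]
        rfl
    _ = ∑ i : ZMod b, (b : ℝ)⁻¹ * powFieldZ J c (moveExp b κ e) := by
        refine Finset.sum_congr rfl fun i _ => ?_
        rw [sliceExp_eq_moveExp_comp_plaqShift b κ he i, powFieldZ_comp_plaqShift]
    _ = powFieldZ J c (moveExp b κ e) := by
        rw [Finset.sum_const, Finset.card_univ, ZMod.card, nsmul_eq_mul, ← mul_assoc,
          mul_inv_cancel₀ (Nat.cast_ne_zero.2 (NeZero.ne b)), one_mul]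

/-! ### Iterating over the directions -/

/-- The exponent field after the moves along the directions in `S`: `b^{#{κ ∈ S : κ ⊥ p}}` if every processed
perpendicular coordinate of `p` is `≡ 0 (mod b)`, else `0`. -/
def mkExpS (S : Finset (Fin d)) (p : Plaquette d (b * L)) : ℕ :=
  if ∀ κ ∈ S, κ ∈ perpDirs p → resb b L (p.1 κ) = 0 then b ^ (S.filter (fun κ => κ ∈ perpDirs p)).card else 0

omit [NeZero b] [NeZero L] in
/-- Before any move every plaquette carries `f^1`. -/
theorem mkExpS_empty : mkExpS (d := d) (L := L) b ∅ = fun _ => 1 := by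
  funext p
  simp [mkExpS]

omit [NeZero b] [NeZero L] in
/-- `mkExpS S` is invariant under the unit translation along an unprocessed direction. -/
theorem mkExpS_plaqShift_single {S : Finset (Fin d)} {κ : Fin d} (hκ : κ ∉ S) (p : Plaquette d (b * L)) :
    mkExpS (L := L) b S (plaqShift (Pi.single κ 1) p) = mkExpS b S p := by
  have hcoord : ∀ μ ∈ S, (plaqShift (Pi.single κ (1 : ZMod (b * L))) p).1 μ = p.1 μ := by
    intro μ hμ
    have hne : μ ≠ κ := fun h => hκ (h ▸ hμ)
    simp [plaqShift, Pi.single_eq_of_ne hne]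
  unfold mkExpS
  simp only [perpDirs_plaqShift]
  have hiff : (∀ μ ∈ S, μ ∈ perpDirs p → resb b L ((plaqShift (Pi.single κ (1 : ZMod (b * L))) p).1 μ) = 0) ↔
      (∀ μ ∈ S, μ ∈ perpDirs p → resb b L (p.1 μ) = 0) :=
    forall₂_congr fun μ hμ => by rw [hcoord μ hμ]
  simp only [hiff]

omit [NeZero b] [NeZero L] in
/-- **One more direction**: moving along `κ ∉ S` turns `mkExpS S` into `mkExpS (insert κ S)`. -/
theorem moveExp_mkExpS {S : Finset (Fin d)} {κ : Fin d} (hκ : κ ∉ S) :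
    moveExp b κ (mkExpS (L := L) b S) = mkExpS b (insert κ S) := by
  funext p
  unfold moveExp sliceExp mkExpS
  by_cases hperp : κ ∈ perpDirs p
  · rw [if_pos hperp]
    have hfilter : (insert κ S).filter (fun μ => μ ∈ perpDirs p) = insert κ (S.filter fun μ => μ ∈ perpDirs p) := by
      rw [Finset.filter_insert, if_pos hperp]
    have hcard : ((insert κ S).filter (fun μ => μ ∈ perpDirs p)).card = (S.filter fun μ => μ ∈ perpDirs p).card + 1 := by
      rw [hfilter, Finset.card_insert_of_notMem (fun h => hκ (Finset.mem_filter.1 h).1)]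
    have hcond : (∀ μ ∈ insert κ S, μ ∈ perpDirs p → resb b L (p.1 μ) = 0) ↔
        (resb b L (p.1 κ) = 0 ∧ ∀ μ ∈ S, μ ∈ perpDirs p → resb b L (p.1 μ) = 0) := by
      rw [Finset.forall_mem_insert]
      exact and_congr_left fun _ => ⟨fun h => h hperp, fun h _ => h⟩
    rw [hcard]
    by_cases hres : resb b L (p.1 κ) = 0
    · rw [if_pos hres]
      by_cases hS : ∀ μ ∈ S, μ ∈ perpDirs p → resb b L (p.1 μ) = 0
      · rw [if_pos hS, if_pos (hcond.2 ⟨hres, hS⟩), pow_succ, mul_comm]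
      · rw [if_neg hS, mul_zero, if_neg (fun h => hS (hcond.1 h).2)]
    · rw [if_neg hres, if_neg (fun h => hres (hcond.1 h).1)]
  · rw [if_neg hperp]
    have hfilter : (insert κ S).filter (fun μ => μ ∈ perpDirs p) = S.filter fun μ => μ ∈ perpDirs p := by
      rw [Finset.filter_insert, if_neg hperp]
    have hcond : (∀ μ ∈ insert κ S, μ ∈ perpDirs p → resb b L (p.1 μ) = 0) ↔
        (∀ μ ∈ S, μ ∈ perpDirs p → resb b L (p.1 μ) = 0) := by
      rw [Finset.forall_mem_insert]
      exact ⟨fun h => h.2, fun h => ⟨fun h' => absurd h' hperp, h⟩⟩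
    rw [hfilter]
    simp only [hcond]

/-- **Potential moving along any set of directions bounds `Z` above**: `Z_{(ℤ/bL)^d}({c_j}) ≤ Z(mkExpS S)`. -/
theorem torusZ_le_powFieldZ_mkExpS (J : ℕ) {c : ℕ → ℝ} (hf : ∀ g : SU2, 0 ≤ plaqFn J c g) (S : Finset (Fin d)) :
    torusZ d (b * L) J c ≤ powFieldZ J c (mkExpS (L := L) b S) := by
  induction S using Finset.induction_on with
  | empty => rw [mkExpS_empty, torusZ_eq_powFieldZ_one]
  | insert κ S hκ ih =>
    calc torusZ d (b * L) J c ≤ powFieldZ J c (mkExpS b S) := ih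
      _ ≤ powFieldZ J c (moveExp b κ (mkExpS b S)) :=
          powFieldZ_le_powFieldZ_moveExp b J hf κ (mkExpS_plaqShift_single b hκ)
      _ = powFieldZ J c (mkExpS b (insert κ S)) := by rw [moveExp_mkExpS b hκ]

omit [NeZero L] in
/-- A plaquette has `d - 2` perpendicular directions. -/
theorem card_perpDirs (p : Plaquette d L) : (perpDirs p).card = d - 2 := by
  have hne : p.2.1.1 ≠ p.2.1.2 := ne_of_lt p.2.2
  have h : perpDirs p = (univ.erase p.2.1.1).erase p.2.1.2 := by
    ext κ
    simp only [mem_perpDirs, Finset.mem_erase, Finset.mem_univ, and_true]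
    tauto
  rw [h, Finset.card_erase_of_mem (Finset.mem_erase.2 ⟨hne.symm, Finset.mem_univ _⟩),
    Finset.card_erase_of_mem (Finset.mem_univ _), Finset.card_univ, Fintype.card_fin]
  omega

omit [NeZero b] [NeZero L] in
/-- **The completely moved exponent field** (arXiv:0707.2179 (2.17), (RG5): total renormalisation `ζ = b^{d-2}`):
after all `d` directions a plaquette carries `f^{b^{d-2}}` if all its perpendicular coordinates are `≡ 0 (mod b)`
(it tiles a plaquette of the coarse lattice `(ℤ/Lℤ)^d` of spacing `b`), and `1` otherwise. -/
theorem mkExpS_univ (p : Plaquette d (b * L)) :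
    mkExpS b (univ : Finset (Fin d)) p = if ∀ κ ∈ perpDirs p, resb b L (p.1 κ) = 0 then b ^ (d - 2) else 0 := by
  unfold mkExpS
  rw [Finset.filter_univ_mem, card_perpDirs]
  simp only [Finset.mem_univ, true_implies]

/-- **Potential moving bounds the partition function above** (the inequality half of arXiv:0707.2179 Prop. III.1,
App. A §4 up to (A.19)): on the positivity domain `f_c ≥ 0`, for every `d`, `b ≥ 1`, `L ≥ 1` and cut-off `J`,
`Z_{(ℤ/bL)^d}({c_j}) ≤ ∫ ∏_{p on the coarse 2-skeleton} f_c(U_p)^{b^{d-2}} ∏_b dU_b`. -/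
theorem torusZ_fine_le_powFieldZ_mkExp (J : ℕ) {c : ℕ → ℝ} (hf : ∀ g : SU2, 0 ≤ plaqFn J c g) :
    torusZ d (b * L) J c ≤
      powFieldZ J c (fun p : Plaquette d (b * L) =>
        if ∀ κ ∈ perpDirs p, resb b L (p.1 κ) = 0 then b ^ (d - 2) else 0) := by
  have h := torusZ_le_powFieldZ_mkExpS (L := L) b J hf (univ : Finset (Fin d))
  have hfun : mkExpS (L := L) b (univ : Finset (Fin d)) = fun p : Plaquette d (b * L) =>
      if ∀ κ ∈ perpDirs p, resb b L (p.1 κ) = 0 then b ^ (d - 2) else 0 := funext fun p => mkExpS_univ b p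
  rwa [hfun] at h

end Move

end Summit.Ventures.YMGap.Census

end
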